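import Summits.Parity.GeneralizedHardyLittlewood.Theorems.PrimeLevelFamEdgeMomentsBeyondDiagonalDiagRemTwoFourEstimate
import Summits.Parity.GeneralizedHardyLittlewood.Theorems.PrimeLevelFamEdgeMomentsBeyondDiagonalDiagOrderTwoFourOfR24
import HarnessLib

/-!
# Route `PrimeLevelFamEdge`, crux K_A `MomentsBeyondDiagonal` (stmt-Parity-20007), line «petersson_layers» v4, stub `stub_diag`:
# **THE ORDER-`(2,4)` TARGET OF `stub_diag` IS UNCONDITIONAL** (second order of rung `N = 4`)

Composition of `…DiagRemTwoFourEstimate.remainder_estimate₂₄` ((R₂₄), lineage famedge-1 g15) with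
`…DiagOrderTwoFourOfR24.orderTwoFour_target_of_remainder` ((Poly₂₄) + (M4P2) discharged, lineage famedge-2 g7, p835631):

* `orderTwoFour_target` — **the order-`(2,4)` target of `…DiagOrderSelberg.subDiag_of_selbergOrderAsymptotics(_of_le)`
  (`τ₂₄(Δ′,P) = Δ′²·(Δ′⁴𝔎₂₄(1/Δ′,P))/(2(π²/6)²)`, `𝔎₂₄ = (π²/6)²(Φ₇/896 − Ψ₅/320 − Ξ₃/64)`) on every window `(1, Δ]`, `Δ ≤ 3/2`,
  with NO hypothesis left** (by `…DiagOrderSymm.selbergOrder_symm` also the order `(4,2)`).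

With `…DiagOrderZeroFourHolds.orderZeroFour_target` (this lineage) rung `N = 4` of `stub_diag` now needs ONLY the order `(4,4)` (famedge-2:
engines `M₈`, `M₆⊗P₂`, `M₄⊗M₄` landed; chain Combine/Split/Poly/Assembly/Target + the remainder (R₄₄), 25 kernels `a, b ≤ 4`, open).
Def-free; theorems only. Helper `--supports stmt-Parity-20007`; closes nothing (`stub_diag : SubDiag` quantifies over every `Q`); K_A, K_B
and the Parity summit are NOT proved; nothing about Landau–Siegel zeros.

## References
* E. Kowalski, P. Michel, J. VanderKam, J. reine angew. Math. 526 (2000), (23)–(28) pp. 13–15, Prop. 5.1 (31) p. 18.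
  [cite: KowalskiMichelVanderKam2000, (23)–(28) pp. 13–15 — derivation (diagonal main term, order (2,4), general Q)]
-/

noncomputable section

open scoped Real ArithmeticFunction.Moebius
open Complex MeasureTheory Polynomial Finset ArithmeticFunction Set intervalIntegral
open Literature.NumberTheory.LFunctions Literature.NumberTheory.LFunctions.KMV2000

namespace Summit.Parity.GeneralizedHardyLittlewood.Theorems.MomentsBeyondDiagonal.DiagCorner

open Summit.Parity.GeneralizedHardyLittlewood.Theorems.MomentsBeyondDiagonal.DiagKernel (orderTwoFour_target_of_remainder)

set_option maxHeartbeats 800000 in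
set_option maxRecDepth 8192 in
-- large statement
/-- **THE ORDER-`(2,4)` TARGET OF `stub_diag`, UNCONDITIONAL** (window `(1, Δ]`, any `Δ ≤ 3/2`).
[cite: KowalskiMichelVanderKam2000, (23)–(28) and Prop. 5.1 — derivation (order-(2,4) piece of the diagonal, general Q)] -/
theorem orderTwoFour_target {Δ : ℝ} (hΔ : Δ ≤ 3 / 2) :
    ∀ P : ℝ[X], KMV2000.Admissible P → ∀ Δ' : ℝ, 1 < Δ' → Δ' ≤ Δ →
      ∃ C : ℝ, ∃ q₀ : ℕ, ∀ (q : ℕ) [NeZero q], q₀ ≤ q →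
        |(Real.log (qhat q))⁻¹ ^ (2 + 4) * qhat q *
          (∑ c ∈ Icc 1 ⌊qhat q ^ Δ'⌋₊, ∑ g ∈ Icc 1 (⌊qhat q ^ Δ'⌋₊ / c), (μ g : ℝ) * c *
        ∑ k₁ ∈ Icc 1 (⌊qhat q ^ Δ'⌋₊ / (c * g)), ∑ k₂ ∈ Icc 1 (⌊qhat q ^ Δ'⌋₊ / (c * g)),
          ((μ (c * g * k₁) : ℝ) * ((psi (c * g * k₁))⁻¹ *
              P.eval (Real.log (qhat q ^ Δ' / ((c * g * k₁ : ℕ) : ℝ)) / Real.log (qhat q ^ Δ'))) / ((c * g * k₁ : ℕ) : ℝ)) *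
            ((μ (c * g * k₂) : ℝ) * ((psi (c * g * k₂))⁻¹ *
              P.eval (Real.log (qhat q ^ Δ' / ((c * g * k₂ : ℕ) : ℝ)) / Real.log (qhat q ^ Δ'))) / ((c * g * k₂ : ℕ) : ℝ)) *
            (∑ d ∈ k₁.divisors, ∑ e ∈ k₂.divisors,
              ∫ u₁ in Ioi (0 : ℝ),
                (Real.log (qhat q / ((k₁ / d * (g * e) : ℕ) : ℝ)) + Real.log u₁) ^ 2 *
                ∫ u₂ in Ioi ((((k₁ / d * (g * e) * (g * d * (k₂ / e)) : ℕ) : ℝ) / qhat q ^ 2) / u₁),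
                  Real.exp (-(u₁ + u₂)) / (1 - Real.exp (-(u₁ + u₂))) ^ 2 *
                  (Real.log (qhat q / ((g * d * (k₂ / e) : ℕ) : ℝ)) + Real.log u₂) ^ 4)) -
          2 * (π ^ 2 / 6) ^ 2 * (qhat q / (Δ' ^ 2 * Real.log (qhat q) ^ 2)) *
            (Δ' ^ 2 * (Δ' ^ 4 * ((π ^ 2 / 6) ^ 2 * ((1 / 896) * (∑ j ∈ Finset.range (7 + 1), ∑ i ∈ Finset.range (j + 1),
            ((7 : ℕ).choose j : ℝ) * (j.choose i : ℝ) * 2 ^ (7 - j) *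
              ∫ u in (0 : ℝ)..1, (((Polynomial.C (1 / Δ') - X) ^ (7 - j) * derivative (derivative (X ^ i * P))) *
                derivative (derivative (X ^ (j - i) * P))).eval u) +
          (-1 / 320) * (∑ j ∈ Finset.range (5 + 1), ∑ i ∈ Finset.range (j + 1),
            ((5 : ℕ).choose j : ℝ) * (j.choose i : ℝ) * 2 ^ (5 - j) *
              ∫ u in (0 : ℝ)..1, (((Polynomial.C (1 / Δ') - X) ^ (5 - j) * (-(2 : ℝ) • (X ^ i * P))) *
                derivative (derivative (X ^ (j - i) * P))).eval u) +
          (-1 / 64) * (∑ j ∈ Finset.range (3 + 1), ∑ i ∈ Finset.range (j + 1),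
            ((3 : ℕ).choose j : ℝ) * (j.choose i : ℝ) * 2 ^ (3 - j) *
              ∫ u in (0 : ℝ)..1, (((Polynomial.C (1 / Δ') - X) ^ (3 - j) * (-(2 : ℝ) • (X ^ i * P))) *
                (-(2 : ℝ) • (X ^ (j - i) * P))).eval u)))) / (2 * (π ^ 2 / 6) ^ 2))| ≤
          C * qhat q * (Real.log (qhat q))⁻¹ ^ 3 := by
  refine orderTwoFour_target_of_remainder (Δ := Δ) ?_
  obtain ⟨E₀₀, E₀₁, E₀₂, E₀₃, E₀₄, E₁₀, E₁₁, E₁₂, E₁₃, E₁₄, E₂₀, E₂₁, E₂₂, E₂₃, E₂₄, μ₂, μ₄, μ₆, h⟩ := remainder_estimate₂₄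
  exact ⟨E₀₀, E₀₁, E₀₂, E₀₃, E₀₄, E₁₀, E₁₁, E₁₂, E₁₃, E₁₄, E₂₀, E₂₁, E₂₂, E₂₃, E₂₄, μ₂, μ₄, μ₆, fun P hP Δ' h1 h2 ↦ h P hP Δ' h1 (h2.trans hΔ)⟩

end Summit.Parity.GeneralizedHardyLittlewood.Theorems.MomentsBeyondDiagonal.DiagCorner

end
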